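import Summits.QuantumFields.BalabanUV.T4Continuum.Support.NE7HintOfLandauELChartSU2DecSlice
import Summits.QuantumFields.BalabanUV.T4Continuum.Support.NE7HintOfUhlenbeckChartSU2
import Summits.QuantumFields.BalabanUV.T4Continuum.Support.NE7CubeLandauChart
import HarnessLib

/-!
# GEN 99 RE-THREAD (`…Slice`, Bałaban-slice road, memo `t4/b2b-balaban-t4-ne7-p1-g99/ROAD-G99.md` §3.5 ∕ §3.8): this file is `NE7HintOfUhlenbeckChartSU2Dec`'s CHAIN THEOREM VERBATIM except that
# the slice `T_♮(U♯) = frameFreeBlockLandauW` of the per-pair binder is replaced by an ABSTRACT SLICE FAMILY `𝒯 k U♯` with the two hypotheses (hT) «tangent-critical ⟹ critical on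
# `𝒯 j W`» and (hP) «class SlicePoincare for `𝒯 j W`» in the generic theorems, and by the corner-free energy block-Landau slice `𝒯_E = energyBlockLandauW` (both hypotheses
# DISCHARGED: `hT_energyBlockLandau`, `classSlicePoincare_energyBlockLandau_SU2`, constant `8·CPLine 4 2 2 10⁻¹⁷ 10⁻⁵³ + 1`) in the SU(2) `d = 4` `L = 2` theorems; chain predecessors are
# the `…Slice` ∕ `…GenericSlice` re-issues (lineage `b2b-balaban-t4-ne7-p1` gen 99, CRUX PROVER NE7 #1).  NOT NE7; spine 0∕9.  Original docstring follows.

# GEN 95 RE-THREAD (`…Dec`): this file is `NE7HintOfUhlenbeckChartSU2`'s CHAIN THEOREM VERBATIM except that F31's per-pair binder `hleaves` (row NE3's weight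
# currency, numerically refuted for arbitrary pairs — memo `t4/b2b-balaban-t4-ne7-p1-g95/WEIGHT-CURRENCY-DEAD.md`) is replaced by F327's honest binder `hdecomp`
# (decomposition `X = X_T + X_N` with its two energy letters and k-free currencies `(α̂, ν̂, κ̂)`) and route Π's uniform block by ONE k-free line; the chart
# content is untouched (auxiliary theorems are imported from the original files BY NAME) and chain predecessors are the `…Dec` re-issues.  Original docstring follows.

# Support | NE7 END OF RECORD over `NE7HintOfLandauELChartSU2`: the chart input (LSUP-EL) DISCHARGED, `SU(2)`/`U(2)`, d = 4

Informal class name: ROW NE7's HINT THEOREM WITH THE LANDAU-CHART INPUT SUPPLIED BY THE ONE-SCALE LATTICE UHLENBECK LEMMA.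

`NE7HintOfLandauELChartSU2.hint_of_landauELChart_SU2` (the cell's previous END of the NE7 record) takes two inputs: the
local chart hypothesis (LSUP-EL) — around every centre `z`, a unitary gauge in which the minimiser is `e^{A}` with `A` skew,
`‖A‖ ≤ c₀·t/2^{k+1}` and the Euler–Lagrange (Landau) condition of the trace link functional on the cube of radius
`(nbRad + 2ℓ + 12)·2^{k+1} + 2` — and ROW NE3's per-pair binder `hleaves`.  This file DISCHARGES (LSUP-EL): it is supplied,
for every small-field configuration, by the cube Landau chart `NE7CubeLandauChart.cube_landau_chart` (comb gauge + principal
logarithms + the one-scale lattice Uhlenbeck lemma `NE7LatticeUhlenbeckBox.uhlenbeck_box` by incremental minimisation of the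
free-boundary trace link functional + the a priori sup letter `NE7BoxLandauSupAPriori`), with `c₀ = 16384·(2·nbRad + 4ℓ + 28)`
(linear in `ℓ`, as the quantifier order of F306 allows) once `ε ≤ 1/(2.5·10¹⁰·(2·nbRad + 4ℓ + 28)²)`.

THE NEW END OF THE NE7 RECORD: `hint_SU2` — F306's statement with the (LSUP-EL) hypothesis and the constant `c₀` removed; the
only remaining input is ROW NE3's per-pair binder `hleaves` (verbatim as in F306).

HONEST LABEL: finite T⁴ rung (B)+1 — NOT infinite volume, NOT mass gap, NOT `BetaPertH`, NOT Clay.  No `sorry`; axioms ⊆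
{propext, Classical.choice, Quot.sound}.

Worked on by: prover-b2b-balaban-t4-ne7-p1-g93-0 (lineage b2b-balaban-t4-ne7-p1, gen 93: F314b, the END over F306).
-/

open scoped BigOperators Matrix Matrix.Norms.L2Operator Topology
open NormedSpace Finset Set Filter

namespace Summit.QuantumFields.BalabanUV.T4Continuum.NE7HintOfUhlenbeckChartSU2DecSlice

open Literature.MathematicalPhysics.QuantumFieldTheory.Balaban1983to89
open B7Prop1Explicit B7Prop2Explicit MatrixLog UnitaryModel MatrixNorms
open B4TorusKernel.MultiPeriod (torusSupNorm)
open B8Ineq132 (covDiv)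
open T4AveragingDeficitWall (Ad IsUnitaryCfg IsSkewDir SmallField vary curl curlSq dirSq dirL1)
open T4AveragingDeficitWallBoundary (IsPeriodicCfg periodBox)
open AveragingDeficitPeriodicCounting (IsPeriodicDir)
open AveragingDeficitMultiLevelPrep (LevelSmall tower TangentIter)
open BlockAverageVaryHolo (nbRad)
open MinimalActionLevels (perWin)
open MinimalActionSandwich (IsMinimiser admissible)
open MinimalActionRate (sfClass)
open NE3HessForm (dAction)
open NE3SlicePoincareBudgetLine (CPLine)
open NE3TangentCovariantTower (dirIter)
open NE3DecomposedRepOfLinearNormalPart (ResidualSliceRepT)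
open NE3QbarIterCovLiftPrep (cruxC)
open NE3SmoothRightInverseW (rightInvW)
open NE3RightInverseSolveLetters (thetaLoc)
open NE3RightInverseL2Letter (l2C)
open NE3HatInvCurlLetters (curl2C curl1C)
open NE3EnergyShapes (IsUnitarySite)
open NE7HintOfLandauELChartSU2DecSlice (hint_of_landauELChart_SU2)
open NE7HintOfUhlenbeckChartSU2 (regime_arith)
open NE3EnergyWeightedShapes (energyNormW)
open NE7MeanZeroGaugeSliceW (energyBlockLandauW)
open NE7EnergyBlockLandauClassPoincare (classSlicePoincare_energyBlockLandau_SU2)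
open NE7ConvOneStepGenericSlice (hT_energyBlockLandau)
open NE7CubeLandauChart (cube_landau_chart)

variable {n : Type*} [Fintype n] [DecidableEq n]

/-- **ROW NE7's END OF RECORD, THE LANDAU-CHART INPUT DISCHARGED**: F306 `hint_of_landauELChart_SU2` with its hypothesis
(LSUP-EL) supplied by the cube Landau chart `NE7CubeLandauChart.cube_landau_chart` (one-scale lattice Uhlenbeck lemma); the
only remaining input is ROW NE3's per-pair binder `hleaves`. [folklore] -/
theorem hint_SU2 [Nonempty n] (hn : Fintype.card n = 2) :
    ∃ ℓ : ℕ, 1 ≤ ℓ ∧ ∃ ε₀ : ℝ, 0 < ε₀ ∧ ∀ ε : ℝ, 0 < ε → ε ≤ ε₀ → ∃ β₀ : ℝ, 0 < β₀ ∧ ∀ β : ℝ, 0 < β → β ≤ β₀ →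
    ∀ (N : ℕ) [NeZero N] (αh νh κh : ℝ), 1 ≤ N →
    -- the k-free ceilings `(α̂, ν̂, κ̂)` of the honest per-pair binder and ONE k-free strict line (F327)
    2 * κh < ((((1 / 2 - νh ^ 2) / (2 * (1 + (8 * CPLine 4 2 2 (1 / 10 ^ 17) (1 / 10 ^ 53) + 1))) - νh ^ 2) / 2 - 576 * ((4 : ℕ) : ℝ) * (αh ^ 2 * Real.exp (2 * αh))) / (Fintype.card n : ℝ) - 28 * ((4 : ℕ) : ℝ) * (ε + 7 * αh ^ 2)) →
    -- THE HONEST PER-PAIR BINDER `hdecomp` on the data class (F327's)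
    (∀ D : Site 4 → Fin 4 → (Matrix n n ℂ)ˣ, IsUnitaryCfg D → IsPeriodicCfg D (N : ℤ) → SmallField D (4 * (Real.exp β - 1)) → ∀ (k : ℕ), ∀ Us ∈ admissible (sfClass 4 2 N ε) 2 (k + 1) D, SmallField Us ((1 / ((2 : ℕ) : ℝ) ^ 2 * ε / 2) / (((2 : ℕ) : ℝ) ^ (k + 1)) ^ 2) → (∀ φ : Site 4 → Fin 4 → Matrix n n ℂ, IsSkewDir φ → IsPeriodicDir φ ((N * 2 ^ (k + 1) : ℕ) : ℤ) → TangentIter 2 k Us φ → dAction Us φ (perWin 4 (N * 2 ^ (k + 1))) = 0) → ∀ U' ∈ admissible (sfClass 4 2 N ε) 2 (k + 1) D, 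
      ∃ (u : Site 4 → (Matrix n n ℂ)ˣ) (X XT XN : Site 4 → Fin 4 → Matrix n n ℂ) (α ν κ : ℝ),
        IsUnitarySite u ∧ IsSkewDir X ∧ IsPeriodicDir X ((N * 2 ^ (k + 1) : ℕ) : ℤ) ∧ 0 ≤ α ∧ (∀ x μ, ‖X x μ‖ ≤ α) ∧
        gaugeAct u U' = vary Us X 1 ∧
        X = XT + XN ∧ XT ∈ energyBlockLandauW (d := 4) (n := n) 2 N (k + 1) Us ∧ IsSkewDir XN ∧ 0 ≤ ν ∧
        energyNormW 2 (k + 1) Us XN (periodBox (d := 4) (N * 2 ^ (k + 1)))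
          ≤ ν * energyNormW 2 (k + 1) Us X (periodBox (d := 4) (N * 2 ^ (k + 1))) ∧
        ε / (((2 : ℕ) : ℝ) ^ (k + 1)) ^ 2 * (∑ p ∈ perWin 4 (N * 2 ^ (k + 1)), ‖curl Us XN p‖)
          ≤ κ * energyNormW 2 (k + 1) Us X (periodBox (d := 4) (N * 2 ^ (k + 1))) ^ 2 ∧
        α * ((2 : ℕ) : ℝ) ^ (k + 1) ≤ αh ∧ ν ≤ νh ∧ κ ≤ κh) →
    ∃ δV : ℝ, 0 < δV ∧
      ∀ V ∈ {V : Site 4 → Fin 4 → (Matrix n n ℂ)ˣ | IsUnitaryCfg V ∧ IsPeriodicCfg V (N : ℤ) ∧ SmallField V δV},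
      ∀ k : ℕ, ∃ U : Site 4 → Fin 4 → (Matrix n n ℂ)ˣ, IsMinimiser 4 (sfClass 4 2 N ε) 2 N k V U ∧
        ∃ a : ℝ, 0 ≤ a ∧ a < ε / (((2 : ℕ) : ℝ) ^ k) ^ 2 ∧ SmallField U a := by
  set nb : ℝ := (nbRad 4 2 : ℝ) with hnb
  have hnb0 : 0 ≤ nb := Nat.cast_nonneg _
  set Acoef : ℝ := 16384 * (2 * nb + 32) with hAcoef
  obtain ⟨ℓ, hℓ1, ε₀, hε₀, H⟩ := hint_of_landauELChart_SU2 (n := n) hn (A := Acoef) (by positivity) 1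
  have hℓ0 : (0 : ℝ) ≤ (ℓ : ℝ) := Nat.cast_nonneg ℓ
  set c : ℝ := 2 * nb + 4 * (ℓ : ℝ) + 28 with hc
  have hc1 : 1 ≤ c := by rw [hc]; linarith
  set ε₁ : ℝ := 1 / (25000000000 * c ^ 2) with hε₁
  refine ⟨ℓ, hℓ1, min ε₀ ε₁, lt_min hε₀ (by positivity), fun ε hε hεle => ?_⟩
  obtain ⟨β₀, hβ₀, H2⟩ := H ε hε (hεle.trans (min_le_left _ _))
  refine ⟨β₀, hβ₀, fun β hβ hβle N _ αh νh κh hN hline hdecomp => ?_⟩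
  have hεε₁ : ε ≤ 1 / (25000000000 * c ^ 2) := hεle.trans (min_le_right _ _)
  refine H2 β hβ hβle N αh νh κh (16384 * c) hN hline (by positivity) ?_ ?_ hdecomp
  · -- `c₀ = 16384 c ≤ Acoef (ℓ+1)`
    rw [pow_one, hAcoef, hc]; nlinarith only [mul_nonneg hnb0 hℓ0, hℓ0, hnb0]
  -- (LSUP-EL) from the cube chart
  intro D _ _ _ k U hU _ r hr0 hr hUr z
  have hUu : IsUnitaryCfg U := hU.1.1
  set M : ℝ := ((2 : ℕ) : ℝ) ^ (k + 1) with hM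
  have hM2 : 2 ≤ M := by
    rw [hM]; push_cast
    calc (2 : ℝ) = 2 ^ 1 := by norm_num
      _ ≤ 2 ^ (k + 1) := pow_le_pow_right₀ (by norm_num) (by omega)
  have hM0 : 0 < M := by linarith
  set η : ℝ := (r + ε) / (((2 : ℕ) : ℝ) ^ (k + 1)) ^ 2 with hη
  have hη0 : 0 < η := by positivity
  have hSη : SmallField U η := MinimalActionRate.SmallField.mono hUr (div_le_div_of_nonneg_right (by linarith only [hε]) (by positivity))
  have ht₀ : M ^ 2 * η = r + ε := by rw [hη, hM]; field_simp
  have hr4 : r + ε ≤ 5 / 4 * ε := by have e := hr; norm_num at e; linarith only [e]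
  -- the box sizes
  have hRr : ((((nbRad 4 2 + 2 * ℓ + 12) * 2 ^ (k + 1) + 2 : ℕ) : ℝ)) = (nb + 2 * (ℓ : ℝ) + 12) * M + 2 := by
    rw [hnb, hM]; push_cast; ring
  have hX : ((2 * ((nbRad 4 2 + 2 * ℓ + 12) * 2 ^ (k + 1) + 2) + 2 + 1 : ℕ) : ℝ) ≤ c * M := by
    have h1 : ((2 * ((nbRad 4 2 + 2 * ℓ + 12) * 2 ^ (k + 1) + 2) + 2 + 1 : ℕ) : ℝ) = 2 * ((nb + 2 * (ℓ : ℝ) + 12) * M + 2) + 3 := by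
      rw [← hRr]; push_cast; ring
    rw [h1, hc]; linarith only [hM2]
  have hX1 : (1 : ℝ) ≤ ((2 * ((nbRad 4 2 + 2 * ℓ + 12) * 2 ^ (k + 1) + 2) + 2 + 1 : ℕ) : ℝ) := by
    have : 1 ≤ 2 * ((nbRad 4 2 + 2 * ℓ + 12) * 2 ^ (k + 1) + 2) + 2 + 1 := by omega
    exact_mod_cast this
  have hX₂ : ((2 * ((nbRad 4 2 + 2 * ℓ + 12) * 2 ^ (k + 1) + 2) + 2 : ℕ) : ℝ) ≤ c * M := by
    have h1 : ((2 * ((nbRad 4 2 + 2 * ℓ + 12) * 2 ^ (k + 1) + 2) + 2 : ℕ) : ℝ) = 2 * ((nb + 2 * (ℓ : ℝ) + 12) * M + 2) + 2 := by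
      rw [← hRr]; push_cast; ring
    rw [h1, hc]; linarith only [hM2]
  obtain ⟨hA1, hA2, hA3, hA4⟩ := regime_arith (Nn := (Fintype.card n : ℝ)) hM2 hX hX1 hX₂ (Nat.cast_nonneg _) hc1 hη0 ht₀ hr4 hεε₁
    (by rw [hn]; norm_num)
  obtain ⟨u, A₀, hu, hUA, hskew, hA0, hEL⟩ :=
    cube_landau_chart (n := n) hUu hη0 hSη ((nbRad 4 2 + 2 * ℓ + 12) * 2 ^ (k + 1) + 2) z hA1 hA2 hA3
  refine ⟨u, A₀, hu, hUA, hskew, fun q μ hq => (hA0 q μ hq).trans (hA4.trans ?_), hEL⟩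
  -- `16384 c (r+ε)/M ≤ 16384 c (r + 4(e^β − 1) + ε)/M`
  rw [hM]
  apply div_le_div_of_nonneg_right _ (by positivity)
  apply mul_le_mul_of_nonneg_left _ (by positivity)
  linarith only [Real.add_one_le_exp β, hβ]

end Summit.QuantumFields.BalabanUV.T4Continuum.NE7HintOfUhlenbeckChartSU2DecSlice
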